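import Literature.AlgebraicGeometry.Resolution.KnafKuhlmann2005Thm34Stability
import Literature.AlgebraicGeometry.Resolution.GeneralizedStabilityHolds
import Literature.AlgebraicGeometry.Resolution.DefectTransport
import Literature.AlgebraicGeometry.Resolution.Kuhlmann2019HenselianRationality
import Summits.ResolutionOfSingularities.ResolutionOfSingularities.Theorems.AbhyankarShadowsShadowsUniformizeLinDisjoint
import Summits.ResolutionOfSingularities.ResolutionOfSingularities.Theorems.AbhyankarShadowsShadowsUniformizeSeparablyGenerated
import Summits.ResolutionOfSingularities.ResolutionOfSingularities.Theorems.AbhyankarShadowsShadowsUniformizeSeparatingTower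
import Summits.ResolutionOfSingularities.ResolutionOfSingularities.Theorems.AbhyankarShadowsShadowsUniformizeDenseTower
import Summits.ResolutionOfSingularities.ResolutionOfSingularities.Theorems.AbhyankarShadowsShadowsUniformizeIsAbhyankarPlaceMap
import Summits.ResolutionOfSingularities.ResolutionOfSingularities.Theorems.AbhyankarShadowsShadowsUniformizePullback
import Literature.AlgebraicGeometry.Resolution.SubfieldTransport
import Literature.AlgebraicGeometry.Resolution.SmoothUniformization
import HarnessLib

/-!
# Knaf–Kuhlmann 2009, Thm. 1.5 over an algebraically closed ground field: the dense-Abhyankar branch of `ShadowsUniformize`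

Dense-Abhyankar branch of the birth line of the crux `ShadowsUniformize` (route
`AbhyankarShadows`, item stmt-ResolutionOfSingularities-16756), lead c2: the AMBIENT theorem
(`knafKuhlmann2009_thm15_denseAbhyankar`) and its TYPED corollary in the crux's vocabulary
(`lurelRational_of_isDenseAbhyankar`: relative local uniformization at the rational places of a
function field `K/k`, `k` algebraically closed of characteristic `p`, that lie in the completion of
an Abhyankar subfunction field `K₀` — Kuhlmann's places "very close to Abhyankar places", in
general neither Abhyankar nor discrete; the discrete rational places of
`lurelRational_of_isCyclic_valueGroup` are the case `K₀ = k(t)`).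

**Theorem** (Knaf–Kuhlmann 2009, Thm. 1.5, case `P|_K = id`). Let `(Ω, V)` be an algebraically
closed valued field of characteristic `p`, `k' ≤ F₀ ≤ K'` subfields with `k'` perfect and
`k' ⊆ O_V` (trivially valued constants), `F₀ | k'` and `K' | k'` finitely generated, `V` an
ABHYANKAR place of `F₀ | k'` (`IsAbhyankarPlace`) and `K'` DENSE over `F₀` (`IsDenseIn`: "`(F, P)`
lies in the completion of `(F₀, P)`"). Then every finite `Z ⊆ O_V ∩ K'` is smoothly
`O_{k'}`-uniformizable (`IsSmoothlyUniformizableIn`), i.e. `P` is strongly smoothly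
`k'`-uniformizable on `K'`.

Proof, as in the paper (p. 14): the Generalized Stability Theorem (`Kuhlmann2010Stability_holds`,
PROVED in the tree; the Abhyankar place has transcendence defect `0`,
`transcendenceDefect_comap_eq_zero_of_isAbhyankarPlace`) makes `(F₀, V ∩ F₀)` a defectless field;
Lemma 3.12 (immediate over defectless ⇒ separable) in the form
`stub_linDisjoint_of_dense_defectless` (landed) feeds Mac Lane's criterion
`stub_separablyGenerated_of_linDisjoint` (landed), so `K' | F₀` is separably generated; a separating
transcendence basis in tower form (`stub_separatingTower`, landed) is climbed by Prop. 3.11 over the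
Abhyankar base (`stub_denseTower_ambient`, landed: KK05 Thm. 1.1 on `F₀`, dense transcendental and
separable-algebraic steps, Cor. 3.6).

## Source

* H. Knaf, F.-V. Kuhlmann, *Every place admits local uniformization in a finite extension of the
  function field*, Adv. Math. 221 (2009) 428–453 = arXiv:math/0702856: Thm. 1.5, Prop. 3.11,
  Lemma 3.12 (p. 14). [KnafKuhlmann2009]
-/

noncomputable section

-- single-problem summit: the doubled namespace component is forced
set_option linter.dupNamespace false

open Literature.AlgebraicGeometry.Resolution IsLocalRing

namespace Summit.ResolutionOfSingularities.ResolutionOfSingularities.Theorems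

/-- **An Abhyankar place of a function field over trivially valued constants is a defectless
field** (the Generalized Stability Theorem, Kuhlmann 2010 Thm. 1.1, PROVED in the tree as
`Kuhlmann2010Stability_holds`, read for a subfield `F₀` of an ambient valued field `(Ω, V)`:
`F₀ | k'` finitely generated, `k' ⊆ O_V`, `IsAbhyankarPlace V k' F₀`).
[cite: Kuhlmann2010, Thm. 1.1] -/
theorem isDefectlessField_of_isAbhyankarPlace {Ω : Type} [Field Ω] (V : ValuationSubring Ω)
    (k' F₀ : Subfield Ω) (hk : k' ≤ F₀) (hfg₀ : FGOver k' F₀) (hkV : (k' : Set Ω) ⊆ V)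
    (hA : IsAbhyankarPlace V k' F₀) :
    IsDefectlessField F₀ (V.comap (algebraMap F₀ Ω)) := by
  classical
  have _ := hk
  obtain ⟨s₀, hs₀⟩ := hfg₀
  set M : IntermediateField k' Ω := IntermediateField.adjoin k' (s₀ : Set Ω) with hM
  have hMF : ∀ z : Ω, z ∈ M ↔ z ∈ F₀ := fun z => by
    rw [hM, mem_adjoin_subfield_iff, hs₀]
  have hfgM : (⊤ : IntermediateField k' M).FG :=
    IntermediateField.fg_top_iff.mpr
      (IntermediateField.essFiniteType_iff.mpr (IntermediateField.fg_adjoin_finset s₀))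
  have hkM : ∀ c : k', algebraMap k' M c ∈ V.comap (algebraMap M Ω) :=
    algebraMap_mem_comap_intermediateField V M hkV
  have hD : transcendenceDefect k' (V.comap (algebraMap M Ω)) hkM = 0 :=
    transcendenceDefect_comap_eq_zero_of_isAbhyankarPlace V M hMF hkV hfgM hA
  have hdefM : IsDefectlessField M (V.comap (algebraMap M Ω)) :=
    Kuhlmann2010Stability_holds k' M hfgM _ hkM hD
  have hMF' : M.toSubfield = F₀ := by
    ext z
    exact hMF z
  let φ : M ≃+* F₀ := RingEquiv.subfieldCongr hMF'
  have hφ : ∀ x : M, ((φ x : F₀) : Ω) = (x : Ω) := fun x => rfl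
  refine IsDefectlessField.congr φ ?_ hdefM
  ext x
  rw [ValuationSubring.mem_comap, ValuationSubring.mem_comap, ValuationSubring.mem_comap,
    IntermediateField.algebraMap_apply]
  change (x : Ω) ∈ V ↔ ((φ x : F₀) : Ω) ∈ V
  rw [hφ]

/-- **Knaf–Kuhlmann 2009, Thm. 1.5 (case `P|_K = id`), ambient form, PROVED.** For `k' ≤ F₀ ≤ K'`
subfields of an algebraically closed valued field `(Ω, V)` of characteristic `p`, `k'` perfect and
`⊆ O_V`, `F₀ | k'` and `K' | k'` finitely generated, `V` an Abhyankar place of `F₀ | k'` and `K'`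
dense over `F₀` ("`(F, P)` lies in the completion of the Abhyankar subfunction field
`(F₀, P)`"): every finite `Z ⊆ O_V ∩ K'` is smoothly `O_{k'}`-uniformizable — `P` is strongly
smoothly `k'`-uniformizable. (Stability theorem ⇒ `F₀` defectless; Lemma 3.12 ⇒ `K' | F₀` linearly
disjoint from `F₀^{1/p}`; Mac Lane ⇒ separably generated; Prop. 3.11 over the KK05 base.)
[cite: KnafKuhlmann2009, Thm. 1.5] -/
theorem knafKuhlmann2009_thm15_denseAbhyankar {Ω : Type} [Field Ω] [IsAlgClosed Ω] (p : ℕ)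
    [Fact p.Prime] [CharP Ω p] (V : ValuationSubring Ω) (k' F₀ K' : Subfield Ω) [PerfectField k']
    (hk : k' ≤ F₀) (hF₀K : F₀ ≤ K') (hfg₀ : FGOver k' F₀) (hfg : FGOver k' K')
    (hkV : (k' : Set Ω) ⊆ V) (hA : IsAbhyankarPlace V k' F₀) (hdense : IsDenseIn V F₀ K')
    (Z : Finset Ω) (hZ : ∀ z ∈ Z, z ∈ V ∧ z ∈ K') :
    IsSmoothlyUniformizableIn ↥(V.toSubring ⊓ k'.toSubring) V K' (Z : Set Ω) := by
  -- `(F₀, V ∩ F₀)` is a defectless field (Generalized Stability Theorem)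
  have hdef : IsDefectlessField F₀ (V.comap (algebraMap F₀ Ω)) :=
    isDefectlessField_of_isAbhyankarPlace V k' F₀ hk hfg₀ hkV hA
  -- Lemma 3.12: linear disjointness from `F₀^{1/p}`
  have hld : ∀ (n : ℕ) (d s : Fin n → Ω), (∀ i, d i ^ p ∈ F₀) → (∀ i, s i ∈ K') →
      LinearIndependent F₀ s → ∑ i, d i * s i = 0 → ∀ i, d i = 0 :=
    stub_linDisjoint_of_dense_defectless V p F₀ K' hF₀K hdense hdef
  -- Mac Lane: `K' | F₀` is separably generated; a separating tower
  have hfgK : FGOver F₀ K' := FGOver.of_le hfg hk hF₀K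
  have hsep : SeparablyGeneratedOver F₀ K' :=
    stub_separablyGenerated_of_linDisjoint p F₀ K' hF₀K hfgK hld
  obtain ⟨n, x, hxK, htransc, hfinsep⟩ := stub_separatingTower F₀ K' hF₀K hfgK hsep
  -- Prop. 3.11 over the Abhyankar base
  exact stub_denseTower_ambient V k' F₀ K' hk hF₀K hfg₀ hkV hA hdense n x hxK htransc hfinsep Z hZ

/-- **Density is transported along a field embedding** compatible with the valuation rings
(`ι⁻¹(V') = V`). [folklore] -/
theorem isDenseIn_map {Ω Ω' : Type} [Field Ω] [Field Ω'] (ι : Ω →+* Ω')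
    {V : ValuationSubring Ω} {V' : ValuationSubring Ω'} (hV : V'.comap ι = V) {A B : Subfield Ω}
    (h : IsDenseIn V A B) : IsDenseIn V' (A.map ι) (B.map ι) := by
  intro y hy c hc hc0
  obtain ⟨y₀, hy₀, rfl⟩ := Subfield.mem_map.mp hy
  obtain ⟨c₀, hc₀, rfl⟩ := Subfield.mem_map.mp hc
  have hc₀0 : c₀ ≠ 0 := fun h0 => hc0 (by rw [h0, map_zero])
  obtain ⟨z, hz, hlt⟩ := h y₀ hy₀ c₀ hc₀ hc₀0
  refine ⟨ι z, Subfield.mem_map.mpr ⟨z, hz, rfl⟩, ?_⟩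
  rw [← map_sub]
  exact ((isEquiv_valuation_comap ι hV).lt_iff_lt).mpr hlt

/-- **Relative local uniformization at the rational places in the completion of an Abhyankar
subfunction field** (Knaf–Kuhlmann 2009, Thm. 1.5, typed, in the vocabulary of the crux
`ShadowsUniformize` / the target `LurelRational`): for `k` algebraically closed of characteristic
`p`, `K/k` finitely generated, `O ∋ k` a valuation ring of `K` such that for some finitely generated
subextension `K₀` the restriction `O ∩ K₀` is an Abhyankar place of `K₀/k` and `K` is dense over
`K₀` (computed inside `K`), and `R ⊆ O` finitely generated: some finitely generated `A` with
`R ≤ A ⊆ O` and `Frac A = K` is regular at the centre of `O`. (Embed `K ↪ Ω = K̄`, extend `O` to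
`V` (Chevalley), transport finite generation, the Abhyankar property (`stub_isAbhyankarPlace_map`)
and density (`isDenseIn_map`), apply `knafKuhlmann2009_thm15_denseAbhyankar`, pass to the field base
and pull back (`stub_pullback`).) Rationality of `O` is not needed. [cite: KnafKuhlmann2009, Thm. 1.5] -/
theorem lurelRational_of_isDenseAbhyankar :
    ∀ p : ℕ, p.Prime → ∀ (k K : Type) [Field k] [CharP k p] [IsAlgClosed k] [Field K]
      [Algebra k K], (⊤ : IntermediateField k K).FG → ∀ O : ValuationSubring K,
      (∀ c : k, algebraMap k K c ∈ O) →
      (∃ K₀ : IntermediateField k K, K₀.FG ∧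
        IsAbhyankarPlace O (algebraMap k K).fieldRange K₀.toSubfield ∧ IsDenseIn O K₀.toSubfield ⊤) →
      ∀ R : Subalgebra k K, R.FG → R.toSubring ≤ O.toSubring →
      ∃ (A : Subalgebra k K) (h : A.toSubring ≤ O.toSubring), R ≤ A ∧ A.FG ∧
        IsFractionRing A K ∧ IsRegularLocalRing
          (Localization.AtPrime (Ideal.comap (Subring.inclusion h) (IsLocalRing.maximalIdeal O))) := by
  intro p hp k K _ _ _ _ _ hfg O hk hD R hR hRO
  classical
  obtain ⟨K₀, hK₀fg, hA₀, hdense₀⟩ := hD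
  haveI : Fact p.Prime := ⟨hp⟩
  -- ambient data: `Ω = K̄`, `V` over `O`
  let Ω : Type := AlgebraicClosure K
  obtain ⟨V, hV⟩ := exists_valuationSubring_comap_eq (Ω := Ω) O
  subst hV
  set ι : K →+* Ω := algebraMap K Ω with hιdef
  set k' : Subfield Ω := (algebraMap k Ω).fieldRange with hk'def
  set K' : Subfield Ω := ι.fieldRange with hK'def
  set F₀ : Subfield Ω := K₀.toSubfield.map ι with hF₀def
  set k₀ : Subfield K := (algebraMap k K).fieldRange with hk₀
  have hιk : ∀ c : k, ι (algebraMap k K c) = algebraMap k Ω c := fun c =>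
    (IsScalarTower.algebraMap_apply k K Ω c).symm
  haveI : CharP K p := charP_of_injective_algebraMap (algebraMap k K).injective p
  haveI : CharP Ω p := charP_of_injective_algebraMap (algebraMap K Ω).injective p
  haveI : IsAlgClosed k' := IsAlgClosed.of_ringEquiv k k' (algebraMap k Ω).rangeRestrictFieldEquiv
  have hmemV : ∀ z : K, ι z ∈ V ↔ z ∈ V.comap ι := fun z => ValuationSubring.mem_comap.symm
  -- the subfields `k' ≤ F₀ ≤ K'` of `Ω`
  have hk'eq : k₀.map ι = k' := by
    ext z
    simp only [Subfield.mem_map, RingHom.mem_fieldRange, hk₀]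
    constructor
    · rintro ⟨_, ⟨c, rfl⟩, rfl⟩; exact ⟨c, (hιk c).symm⟩
    · rintro ⟨c, rfl⟩; exact ⟨_, ⟨c, rfl⟩, hιk c⟩
  have hK'eq : (⊤ : Subfield K).map ι = K' := by
    rw [hK'def, RingHom.fieldRange_eq_map]
  have hkF₀ : k' ≤ F₀ := by
    rintro _ ⟨c, rfl⟩
    exact Subfield.mem_map.mpr ⟨algebraMap k K c, K₀.algebraMap_mem c, hιk c⟩
  have hF₀K : F₀ ≤ K' := by
    rintro _ ⟨x, -, rfl⟩
    exact ⟨x, rfl⟩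
  have hkV : (k' : Set Ω) ⊆ V := by
    rintro _ ⟨c, rfl⟩
    rw [← hιk]
    exact (hmemV _).mpr (hk c)
  -- finite generation of `K' | k'` and `F₀ | k'`
  have hfgΩ : FGOver k' K' := by
    have hfg₀ : FGOver k₀ (⊤ : Subfield K) := by
      obtain ⟨s, hs⟩ := hfg
      refine ⟨s, ?_⟩
      have h1 : (IntermediateField.adjoin k (s : Set K)).toSubfield =
          Subfield.closure (Set.range (algebraMap k K) ∪ (s : Set K)) := rfl
      rw [RingHom.coe_fieldRange, ← h1, hs]
      rfl
    have h := fgOver_map ι hfg₀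
    rwa [hk'eq, hK'eq] at h
  have hfgF₀ : FGOver k' F₀ := by
    have hfg₀ : FGOver k₀ K₀.toSubfield := by
      obtain ⟨t, ht⟩ := hK₀fg
      refine ⟨t, ?_⟩
      have h1 : (IntermediateField.adjoin k (t : Set K)).toSubfield =
          Subfield.closure (Set.range (algebraMap k K) ∪ (t : Set K)) := rfl
      rw [RingHom.coe_fieldRange, ← h1, ht]
    have h := fgOver_map ι hfg₀
    rwa [hk'eq] at h
  -- the Abhyankar property and density, transported
  have hA : IsAbhyankarPlace V k' F₀ := by
    have h := stub_isAbhyankarPlace_map ι (V := V.comap ι) (V' := V) rfl hA₀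
    rwa [hk'eq] at h
  have hdense : IsDenseIn V F₀ K' := by
    have h := isDenseIn_map ι (V := V.comap ι) (V' := V) rfl hdense₀
    rwa [hK'eq] at h
  -- Knaf–Kuhlmann 2009, Thm. 1.5 in `Ω`, then back to `K`
  have hSU : ∀ Z : Finset Ω, (∀ z ∈ Z, z ∈ V ∧ z ∈ K') →
      IsSmoothlyUniformizableIn k' V K' (Z : Set Ω) := fun Z hZ =>
    (isSmoothlyUniformizableIn_inf_iff V k' hkV K' _).mp
      (knafKuhlmann2009_thm15_denseAbhyankar p V k' F₀ K' hkF₀ hF₀K hfgF₀ hfgΩ hkV hA hdense Z hZ)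
  exact stub_pullback k K Ω (V.comap ι) V rfl hk R hR hRO hSU

end Summit.ResolutionOfSingularities.ResolutionOfSingularities.Theorems

end
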